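import Mathlib
import HarnessLib
import Summits.HubbardSuperconductivity.HubbardSuperconductivity.Theorems.KLProgrammeRadialMassPlanar
import Summits.HubbardSuperconductivity.HubbardSuperconductivity.Theorems.KLProgrammeRungCutoffAlgebraSharp

/-!
# Route `KLProgramme` — crux K3, ENGINE child (`KLRegimeEngineV14`, stmt-HubbardSuperconductivity-19918), stub `stub_engine_step_values`
# (E2-v9) (m)/(neg) and the plain↔Wick transfer: the CERTIFIED planar sign-blind masses of the four rung profiles of `…RungCutoffAlgebra`
# (cell gate-hubbard-kl, seat hubbard-kl-k3c2-p2 «thermal-bar induction n ≤ nScales β + 1»)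

`…RadialMassPlanar` (`klrp_planar_mass_norm_le`) bounds the Matsubara-summed planar sign-blind mass of a radial integrand `F(s)/s` on the frame band
by `2π·B_W·(½∫_{s>0}‖F‖/s + (1024/π)(4ℓ + 16M_F)·(π/β)/Λ_n)`, `B_W = A₀π√2/(Dt_min − κ₁)`.  Here it is fed the four REAL profiles of the one-step
rung algebra (`a = χ₂(s/Λ_n²)`, `b = χ₂(s/Λ_{n−1}²)`, `w = a − b`), with their certified `ds/s`-masses (`klrc_*`):

| profile | `F` | `M_F` | `ℓ` | `½∫‖F‖/s ≤` | decl |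
|---|---|---|---|---|---|
| same slice (sharp) | `w·w` | `1` | `68/3` | `½·log 16` | `klrq_planar_sameSlice_mass_le_sharp` |
| harder partner | `w·b` | `1/4` | `12` | `⅛·log 4` | `klrq_planar_harderPartner_mass_le` |
| softer partner | `w·(1 − a)` | `1/4` | `22` | `⅛·log 4` | `klrq_planar_softerPartner_mass_le` |
| transfer `t_n` | `2a(1 − a)` | `1/2` | `64/3` | `¼·log 4` | `klrq_planar_transfer_mass_le` |

through the generic real-profile form `klrq_planar_realProfile_mass_le`.  Per unit `(2π)²` of `d²p/(2π)²` and mid-ladder (thermal term negligible):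
same slice `≈ 0.22·B_W`, plain rung `w² + 2wb` `≈ 0.28·B_W`, Wick rung `w² + 2w(1−a)` `≈ 0.28·B_W`, transfer `≈ 0.055·B_W` — the numbers of
HOME/hubbard-kl-k3c2-p2/TRANSFER-NOTE.md §2/§4 (evidence #22 on 19918), now kernel-checked up to the Jacobian constant `B_W`.

Pure analysis; nothing about the model is asserted.
-/

noncomputable section

namespace Summit.HubbardSuperconductivity.HubbardSuperconductivity.Theorems.KLRegimeSplit

set_option linter.dupNamespace false -- summit = problem name (single-conjunct summit), D-0017

open Real Set Filter MeasureTheory Complex Literature.MathematicalPhysics.QuantumLattice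
open Literature.MathematicalPhysics.QuantumLattice.BandSectorCounting Literature.Probability.LatticeModels
open Summit.HubbardSuperconductivity.HubbardSuperconductivity.Theorems.PerturbedFermiCurve
open Summit.HubbardSuperconductivity.HubbardSuperconductivity.Theorems.KLProgrammeLegKernels
open Summit.HubbardSuperconductivity.HubbardSuperconductivity.Theorems.DispersionFlow

/-! ## §1 Real Lipschitz facts of the weights at one ladder step (`Λ′ = 4Λ`) -/

/-- `a = χ₂(s/Λ²)` is `(32/3)/Λ²`-Lipschitz. -/
theorem klrq_hard_lipschitz {Λ : ℝ} (hΛ : 0 < Λ) (s s' : ℝ) :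
    |salmhoferCutoff (s / Λ ^ 2) - salmhoferCutoff (s' / Λ ^ 2)| ≤ (32 / 3) / Λ ^ 2 * |s - s'| := by
  have h := klcd_lipschitz_salmhoferCutoff_sharp (s / Λ ^ 2) (s' / Λ ^ 2)
  have hΛ2 : 0 < Λ ^ 2 := by positivity
  rw [← sub_div, abs_div, abs_of_pos hΛ2] at h
  refine h.trans (le_of_eq ?_)
  field_simp

/-- `w = χ₂(s/Λ²) − χ₂(s/(4Λ)²)` is `(34/3)/Λ²`-Lipschitz (real form of `klwt_lipschitz_scale_sharp`). -/
theorem klrq_slice_lipschitz {Λ : ℝ} (hΛ : 0 < Λ) (s s' : ℝ) :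
    |(salmhoferCutoff (s / Λ ^ 2) - salmhoferCutoff (s / (4 * Λ) ^ 2)) -
        (salmhoferCutoff (s' / Λ ^ 2) - salmhoferCutoff (s' / (4 * Λ) ^ 2))| ≤ (34 / 3) / Λ ^ 2 * |s - s'| := by
  have h := klwt_lipschitz_scale_sharp hΛ s s'
  rwa [← Complex.ofReal_sub, Complex.norm_real, Real.norm_eq_abs] at h

/-- `0 ≤ w ≤ 1` and `0 ≤ a, b ≤ 1` at every `s` (for `s < 0` all weights vanish). -/
theorem klrq_weights_mem {Λ : ℝ} (hΛ : 0 < Λ) (s : ℝ) :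
    0 ≤ salmhoferCutoff (s / (4 * Λ) ^ 2) ∧ salmhoferCutoff (s / (4 * Λ) ^ 2) ≤ salmhoferCutoff (s / Λ ^ 2) ∧
      salmhoferCutoff (s / Λ ^ 2) ≤ 1 := by
  rcases le_or_gt 0 s with hs | hs
  · exact ⟨klrc_chi_nonneg _, klrc_hard_weight_anti hΛ (by linarith) hs, klrc_chi_le_one _⟩
  · have ha : salmhoferCutoff (s / Λ ^ 2) = 0 :=
      salmhoferCutoff_of_le ((div_neg_of_neg_of_pos hs (by positivity)).le.trans (by norm_num))
    have hb : salmhoferCutoff (s / (4 * Λ) ^ 2) = 0 :=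
      salmhoferCutoff_of_le ((div_neg_of_neg_of_pos hs (by positivity)).le.trans (by norm_num))
    rw [ha, hb]; norm_num

/-- Product rule for real Lipschitz bounded factors. -/
theorem klrq_mul_lipschitz {f g : ℝ → ℝ} {Mf Mg Lf Lg : ℝ} (hbf : ∀ s, |f s| ≤ Mf) (hbg : ∀ s, |g s| ≤ Mg)
    (hlf : ∀ s s', |f s - f s'| ≤ Lf * |s - s'|) (hlg : ∀ s s', |g s - g s'| ≤ Lg * |s - s'|) (s s' : ℝ) :
    |f s * g s - f s' * g s'| ≤ (Mf * Lg + Mg * Lf) * |s - s'| := by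
  have h1 : f s * g s - f s' * g s' = f s * (g s - g s') + g s' * (f s - f s') := by ring
  rw [h1]
  refine (abs_add_le _ _).trans ?_
  rw [abs_mul, abs_mul]
  have := hbf s; have := hbg s'; have := hlf s s'; have := hlg s s'
  have h0 : 0 ≤ |s - s'| := abs_nonneg _
  nlinarith [abs_nonneg (f s), abs_nonneg (g s'), abs_nonneg (g s - g s'), abs_nonneg (f s - f s')]

/-! ## §2 The generic real-profile planar mass -/

section Frame

variable {a b : ℝ} (B : BandBounds a b) {δ : (Fin 2 → ℝ) → ℝ} (hδ1 : ContDiff ℝ 1 δ) {κ₀ κ₁ : ℝ}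
  (hδ : ∀ k : Fin 2 → ℝ, (∀ i, |k i| ≤ π) → |δ k| ≤ κ₀)
  (hκ : ∀ k : Fin 2 → ℝ, (∀ i, |k i| ≤ π) → ‖fderiv ℝ δ k‖ ≤ κ₁) (hκ₁ : κ₁ < B.Dtmin)

include B hδ1 hδ hκ hκ₁ in
/-- **Planar sign-blind mass of a REAL radial profile** `G` on the slice shell (`|G| ≤ M_F`, `|G(s) − G(s′)| ≤ (ℓ/Λ_n²)|s−s′|`, `G = 0` for
`s ≤ (Λ_n/2)²` and `s ≥ (4Λ_n)²`, `∫_{s>0}|G|/s ≤ m`): `‖β⁻¹ • Σ_i ∫d²p A(p)·G(s)/s‖ ≤ 2π·(A₀π√2/d)·(½·m + (1024/π)(4ℓ+16M_F)(π/β)/Λ_n)`. -/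
theorem klrq_planar_realProfile_mass_le {A : ℝ × ℝ → ℂ} (hA : Continuous A) (hAsupp : ∀ p : ℝ × ℝ, A p ≠ 0 → |p.1| < π ∧ |p.2| < π)
    {A₀ : ℝ} (hA0 : ∀ p, ‖A p‖ ≤ A₀) {G : ℝ → ℝ} {MF ℓ m : ℝ} {n : ℕ} (hbd : ∀ s, |G s| ≤ MF)
    (hlip : ∀ s s', |G s - G s'| ≤ ℓ / klScale klE0 n ^ 2 * |s - s'|)
    (hin : ∀ s, s ≤ (klScale klE0 n / 2) ^ 2 → G s = 0) (hout : ∀ s, (4 * klScale klE0 n) ^ 2 ≤ s → G s = 0)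
    (hm : ∫ s in Ioi (0 : ℝ), |G s| / s ≤ m)
    {μ : ℝ} (hlo : a < μ - 4 * klScale klE0 n - κ₀) (hhi : μ + 4 * klScale klE0 n + κ₀ < b)
    {β : ℝ} (hβ : klBetaMin ≤ β) (hn : n ≤ nScales β + 1) {M : ℕ} (hM : β * (4 * klScale klE0 n) / (2 * Real.pi) + 1 ≤ M) :
    ‖β⁻¹ • ∑ i : MatsubaraIdx M, ∫ p : ℝ × ℝ, A p *
        (((G (matsubaraFreq β M i ^ 2 + klfb_band δ μ p ^ 2) : ℝ) : ℂ) /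
          (((matsubaraFreq β M i ^ 2 + klfb_band δ μ p ^ 2 : ℝ)) : ℂ))‖ ≤
      2 * Real.pi * (A₀ * (Real.pi * Real.sqrt 2 / (B.Dtmin - κ₁)) *
        (1 / 2 * m + 1024 / Real.pi * (4 * ℓ + 16 * MF) * ((Real.pi / β) / klScale klE0 n))) := by
  set F : ℝ → ℂ := fun s => ((G s : ℝ) : ℂ) with hF
  have hFbd : ∀ s, ‖F s‖ ≤ MF := fun s => by rw [hF]; simp only [Complex.norm_real, Real.norm_eq_abs]; exact hbd s
  have hFlip : ∀ s s', ‖F s - F s'‖ ≤ ℓ / klScale klE0 n ^ 2 * |s - s'| := fun s s' => by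
    simp only [hF, ← Complex.ofReal_sub, Complex.norm_real, Real.norm_eq_abs]; exact hlip s s'
  have hFin : ∀ s, s ≤ (klScale klE0 n / 2) ^ 2 → F s = 0 := fun s hs => by simp only [hF, hin s hs, Complex.ofReal_zero]
  have hFout : ∀ s, (4 * klScale klE0 n) ^ 2 ≤ s → F s = 0 := fun s hs => by simp only [hF, hout s hs, Complex.ofReal_zero]
  have hmain := klrp_planar_mass_norm_le B hδ1 hδ hκ hκ₁ hA hAsupp hA0 hFbd hFlip hFin hFout hlo hhi hβ hn hM
  have hmass : ∫ s in Ioi (0 : ℝ), ‖F s‖ / s ≤ m := by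
    refine le_trans (le_of_eq (setIntegral_congr_fun measurableSet_Ioi fun s _ => ?_)) hm
    simp only [hF, Complex.norm_real, Real.norm_eq_abs]
  have hd : 0 < B.Dtmin - κ₁ := by linarith
  have hA0' : 0 ≤ A₀ := (norm_nonneg _).trans (hA0 0)
  have hBW : 0 ≤ A₀ * (Real.pi * Real.sqrt 2 / (B.Dtmin - κ₁)) := by positivity
  refine hmain.trans (mul_le_mul_of_nonneg_left (mul_le_mul_of_nonneg_left (by linarith) hBW) (by positivity))

/-! ## §3 The four rung profiles -/

include B hδ1 hδ hκ hκ₁ in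
/-- **Same-slice rung mass, SHARP**: `F = w_n·w_n`, `½∫ ≤ ½·log 16`, `ℓ = 68/3`, `M_F = 1`. -/
theorem klrq_planar_sameSlice_mass_le_sharp {A : ℝ × ℝ → ℂ} (hA : Continuous A) (hAsupp : ∀ p : ℝ × ℝ, A p ≠ 0 → |p.1| < π ∧ |p.2| < π)
    {A₀ : ℝ} (hA0 : ∀ p, ‖A p‖ ≤ A₀) {n : ℕ} (hn1 : 1 ≤ n)
    {μ : ℝ} (hlo : a < μ - 4 * klScale klE0 n - κ₀) (hhi : μ + 4 * klScale klE0 n + κ₀ < b)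
    {β : ℝ} (hβ : klBetaMin ≤ β) (hn : n ≤ nScales β + 1) {M : ℕ} (hM : β * (4 * klScale klE0 n) / (2 * Real.pi) + 1 ≤ M) :
    ‖β⁻¹ • ∑ i : MatsubaraIdx M, ∫ p : ℝ × ℝ, A p *
        ((((salmhoferCutoff ((matsubaraFreq β M i ^ 2 + klfb_band δ μ p ^ 2) / klScale klE0 n ^ 2) -
              salmhoferCutoff ((matsubaraFreq β M i ^ 2 + klfb_band δ μ p ^ 2) / klScale klE0 (n - 1) ^ 2)) *
            (salmhoferCutoff ((matsubaraFreq β M i ^ 2 + klfb_band δ μ p ^ 2) / klScale klE0 n ^ 2) -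
              salmhoferCutoff ((matsubaraFreq β M i ^ 2 + klfb_band δ μ p ^ 2) / klScale klE0 (n - 1) ^ 2)) : ℝ) : ℂ) /
          (((matsubaraFreq β M i ^ 2 + klfb_band δ μ p ^ 2 : ℝ)) : ℂ))‖ ≤
      2 * Real.pi * (A₀ * (Real.pi * Real.sqrt 2 / (B.Dtmin - κ₁)) *
        (1 / 2 * Real.log 16 + 1024 / Real.pi * (320 / 3) * ((Real.pi / β) / klScale klE0 n))) := by
  have hΛ := klth_klScale_pos n
  have hpred : klScale klE0 (n - 1) = 4 * klScale klE0 n := by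
    obtain ⟨m, rfl⟩ : ∃ m, n = m + 1 := ⟨n - 1, by omega⟩
    rw [Nat.add_sub_cancel, klth_klScale_succ]; ring
  set Λ := klScale klE0 n with hΛdef
  rw [hpred]
  set w : ℝ → ℝ := fun s => salmhoferCutoff (s / Λ ^ 2) - salmhoferCutoff (s / (4 * Λ) ^ 2) with hw
  have hwb : ∀ s, |w s| ≤ 1 := fun s => by
    obtain ⟨h0, hba, h1⟩ := klrq_weights_mem hΛ s
    rw [hw]; simp only; rw [abs_le]; constructor <;> linarith
  have hwl : ∀ s s', |w s - w s'| ≤ (34 / 3) / Λ ^ 2 * |s - s'| := fun s s' => klrq_slice_lipschitz hΛ s s'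
  have hbd : ∀ s, |w s * w s| ≤ 1 := fun s => by
    rw [abs_mul]; have := hwb s; nlinarith [abs_nonneg (w s)]
  have hlip : ∀ s s', |w s * w s - w s' * w s'| ≤ (68 / 3) / Λ ^ 2 * |s - s'| := fun s s' =>
    (klrq_mul_lipschitz hwb hwb hwl hwl s s').trans (le_of_eq (by ring))
  have hin : ∀ s, s ≤ (Λ / 2) ^ 2 → w s * w s = 0 := fun s hs => by
    have h := klwt_zero_of_le hΛ s hs
    have h' : w s = 0 := by rw [hw]; exact_mod_cast h
    rw [h', zero_mul]
  have hout : ∀ s, (4 * Λ) ^ 2 ≤ s → w s * w s = 0 := fun s hs => by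
    have h := klwt_zero_of_ge hΛ s hs
    have h' : w s = 0 := by rw [hw]; exact_mod_cast h
    rw [h', zero_mul]
  have hm : ∫ s in Ioi (0 : ℝ), |w s * w s| / s ≤ Real.log 16 := by
    refine le_trans (le_of_eq (setIntegral_congr_fun measurableSet_Ioi fun s _ => ?_)) (klrc_sameSlice_mass_le_sharp hΛ)
    show |w s * w s| / s = (w s) ^ 2 / s
    rw [abs_mul_self, sq]
  have h := klrq_planar_realProfile_mass_le B hδ1 hδ hκ hκ₁ hA hAsupp hA0 (G := fun s => w s * w s) (MF := 1) (ℓ := 68 / 3)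
    hbd hlip hin hout hm hlo hhi hβ hn hM
  have hnum : (4 : ℝ) * (68 / 3) + 16 * 1 = 320 / 3 := by norm_num
  rw [hnum] at h
  exact h

include B hδ1 hδ hκ hκ₁ in
/-- **Harder-partner rung mass**: `F = w_n·b` (`b = χ₂(s/Λ_{n−1}²)`), `½∫ ≤ ⅛·log 4`, `ℓ = 12`, `M_F = 1/4`. -/
theorem klrq_planar_harderPartner_mass_le {A : ℝ × ℝ → ℂ} (hA : Continuous A) (hAsupp : ∀ p : ℝ × ℝ, A p ≠ 0 → |p.1| < π ∧ |p.2| < π)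
    {A₀ : ℝ} (hA0 : ∀ p, ‖A p‖ ≤ A₀) {n : ℕ} (hn1 : 1 ≤ n)
    {μ : ℝ} (hlo : a < μ - 4 * klScale klE0 n - κ₀) (hhi : μ + 4 * klScale klE0 n + κ₀ < b)
    {β : ℝ} (hβ : klBetaMin ≤ β) (hn : n ≤ nScales β + 1) {M : ℕ} (hM : β * (4 * klScale klE0 n) / (2 * Real.pi) + 1 ≤ M) :
    ‖β⁻¹ • ∑ i : MatsubaraIdx M, ∫ p : ℝ × ℝ, A p *
        ((((salmhoferCutoff ((matsubaraFreq β M i ^ 2 + klfb_band δ μ p ^ 2) / klScale klE0 n ^ 2) -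
              salmhoferCutoff ((matsubaraFreq β M i ^ 2 + klfb_band δ μ p ^ 2) / klScale klE0 (n - 1) ^ 2)) *
            salmhoferCutoff ((matsubaraFreq β M i ^ 2 + klfb_band δ μ p ^ 2) / klScale klE0 (n - 1) ^ 2) : ℝ) : ℂ) /
          (((matsubaraFreq β M i ^ 2 + klfb_band δ μ p ^ 2 : ℝ)) : ℂ))‖ ≤
      2 * Real.pi * (A₀ * (Real.pi * Real.sqrt 2 / (B.Dtmin - κ₁)) *
        (1 / 2 * (1 / 4 * Real.log 4) + 1024 / Real.pi * 52 * ((Real.pi / β) / klScale klE0 n))) := by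
  have hΛ := klth_klScale_pos n
  have hpred : klScale klE0 (n - 1) = 4 * klScale klE0 n := by
    obtain ⟨m, rfl⟩ : ∃ m, n = m + 1 := ⟨n - 1, by omega⟩
    rw [Nat.add_sub_cancel, klth_klScale_succ]; ring
  set Λ := klScale klE0 n with hΛdef
  rw [hpred]
  set w : ℝ → ℝ := fun s => salmhoferCutoff (s / Λ ^ 2) - salmhoferCutoff (s / (4 * Λ) ^ 2) with hw
  set bb : ℝ → ℝ := fun s => salmhoferCutoff (s / (4 * Λ) ^ 2) with hbb
  have hwb : ∀ s, |w s| ≤ 1 := fun s => by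
    obtain ⟨h0, hba, h1⟩ := klrq_weights_mem hΛ s
    rw [hw]; simp only; rw [abs_le]; constructor <;> linarith
  have hwl : ∀ s s', |w s - w s'| ≤ (34 / 3) / Λ ^ 2 * |s - s'| := fun s s' => klrq_slice_lipschitz hΛ s s'
  have hbbb : ∀ s, |bb s| ≤ 1 := fun s => by
    rw [hbb]; simp only; rw [abs_of_nonneg (klrc_chi_nonneg _)]; exact klrc_chi_le_one _
  have hbbl : ∀ s s', |bb s - bb s'| ≤ (2 / 3) / Λ ^ 2 * |s - s'| := fun s s' => by
    have h := klrq_hard_lipschitz (Λ := 4 * Λ) (by positivity) s s'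
    refine h.trans (le_of_eq ?_)
    field_simp; ring
  have hbd : ∀ s, |w s * bb s| ≤ 1 / 4 := fun s => by
    obtain ⟨h0, hba, h1⟩ := klrq_weights_mem hΛ s
    have h := klrc_harder_partner_mem h0 hba h1
    rw [hw, hbb]; simp only; rw [abs_of_nonneg h.1]; exact h.2
  have hlip : ∀ s s', |w s * bb s - w s' * bb s'| ≤ 12 / Λ ^ 2 * |s - s'| := fun s s' =>
    (klrq_mul_lipschitz hwb hbbb hwl hbbl s s').trans (le_of_eq (by ring))
  have hin : ∀ s, s ≤ (Λ / 2) ^ 2 → w s * bb s = 0 := fun s hs => by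
    rw [hw, hbb]; exact klrc_harder_partner_zero_of_le hΛ (by nlinarith)
  have hout : ∀ s, (4 * Λ) ^ 2 ≤ s → w s * bb s = 0 := fun s hs => by
    rw [hw, hbb]; exact klrc_harder_partner_zero_of_ge hΛ (by nlinarith)
  have hm : ∫ s in Ioi (0 : ℝ), |w s * bb s| / s ≤ 1 / 4 * Real.log 4 := by
    refine le_trans (le_of_eq (setIntegral_congr_fun measurableSet_Ioi fun s _ => ?_)) (klrc_harder_partner_mass_le hΛ)
    obtain ⟨h0, hba, h1⟩ := klrq_weights_mem hΛ s
    show |w s * bb s| / s = (salmhoferCutoff (s / Λ ^ 2) - salmhoferCutoff (s / (4 * Λ) ^ 2)) * salmhoferCutoff (s / (4 * Λ) ^ 2) / s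
    rw [hw, hbb]; simp only; rw [abs_of_nonneg (klrc_harder_partner_mem h0 hba h1).1]
  have h := klrq_planar_realProfile_mass_le B hδ1 hδ hκ hκ₁ hA hAsupp hA0 (G := fun s => w s * bb s) (MF := 1 / 4) (ℓ := 12)
    hbd hlip hin hout hm hlo hhi hβ hn hM
  have hnum : (4 : ℝ) * 12 + 16 * (1 / 4) = 52 := by norm_num
  rw [hnum] at h
  exact h

include B hδ1 hδ hκ hκ₁ in
/-- **Softer-partner rung mass** (the Wick rung's partner part): `F = w_n·(1 − a)`, `½∫ ≤ ⅛·log 4`, `ℓ = 22`, `M_F = 1/4`. -/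
theorem klrq_planar_softerPartner_mass_le {A : ℝ × ℝ → ℂ} (hA : Continuous A) (hAsupp : ∀ p : ℝ × ℝ, A p ≠ 0 → |p.1| < π ∧ |p.2| < π)
    {A₀ : ℝ} (hA0 : ∀ p, ‖A p‖ ≤ A₀) {n : ℕ} (hn1 : 1 ≤ n)
    {μ : ℝ} (hlo : a < μ - 4 * klScale klE0 n - κ₀) (hhi : μ + 4 * klScale klE0 n + κ₀ < b)
    {β : ℝ} (hβ : klBetaMin ≤ β) (hn : n ≤ nScales β + 1) {M : ℕ} (hM : β * (4 * klScale klE0 n) / (2 * Real.pi) + 1 ≤ M) :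
    ‖β⁻¹ • ∑ i : MatsubaraIdx M, ∫ p : ℝ × ℝ, A p *
        ((((salmhoferCutoff ((matsubaraFreq β M i ^ 2 + klfb_band δ μ p ^ 2) / klScale klE0 n ^ 2) -
              salmhoferCutoff ((matsubaraFreq β M i ^ 2 + klfb_band δ μ p ^ 2) / klScale klE0 (n - 1) ^ 2)) *
            (1 - salmhoferCutoff ((matsubaraFreq β M i ^ 2 + klfb_band δ μ p ^ 2) / klScale klE0 n ^ 2)) : ℝ) : ℂ) /
          (((matsubaraFreq β M i ^ 2 + klfb_band δ μ p ^ 2 : ℝ)) : ℂ))‖ ≤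
      2 * Real.pi * (A₀ * (Real.pi * Real.sqrt 2 / (B.Dtmin - κ₁)) *
        (1 / 2 * (1 / 4 * Real.log 4) + 1024 / Real.pi * 92 * ((Real.pi / β) / klScale klE0 n))) := by
  have hΛ := klth_klScale_pos n
  have hpred : klScale klE0 (n - 1) = 4 * klScale klE0 n := by
    obtain ⟨m, rfl⟩ : ∃ m, n = m + 1 := ⟨n - 1, by omega⟩
    rw [Nat.add_sub_cancel, klth_klScale_succ]; ring
  set Λ := klScale klE0 n with hΛdef
  rw [hpred]
  set w : ℝ → ℝ := fun s => salmhoferCutoff (s / Λ ^ 2) - salmhoferCutoff (s / (4 * Λ) ^ 2) with hw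
  set c : ℝ → ℝ := fun s => 1 - salmhoferCutoff (s / Λ ^ 2) with hc
  have hwb : ∀ s, |w s| ≤ 1 := fun s => by
    obtain ⟨h0, hba, h1⟩ := klrq_weights_mem hΛ s
    rw [hw]; simp only; rw [abs_le]; constructor <;> linarith
  have hwl : ∀ s s', |w s - w s'| ≤ (34 / 3) / Λ ^ 2 * |s - s'| := fun s s' => klrq_slice_lipschitz hΛ s s'
  have hcb : ∀ s, |c s| ≤ 1 := fun s => by
    rw [hc]; simp only; rw [abs_le]; constructor <;> linarith [klrc_chi_nonneg (s / Λ ^ 2), klrc_chi_le_one (s / Λ ^ 2)]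
  have hcl : ∀ s s', |c s - c s'| ≤ (32 / 3) / Λ ^ 2 * |s - s'| := fun s s' => by
    have h := klrq_hard_lipschitz hΛ s s'
    rw [hc]; simp only
    rw [show (1 - salmhoferCutoff (s / Λ ^ 2)) - (1 - salmhoferCutoff (s' / Λ ^ 2)) =
      -(salmhoferCutoff (s / Λ ^ 2) - salmhoferCutoff (s' / Λ ^ 2)) by ring, abs_neg]
    exact h
  have hbd : ∀ s, |w s * c s| ≤ 1 / 4 := fun s => by
    obtain ⟨h0, hba, h1⟩ := klrq_weights_mem hΛ s
    have h := klrc_softer_partner_mem h0 hba h1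
    rw [hw, hc]; simp only; rw [abs_of_nonneg h.1]; exact h.2
  have hlip : ∀ s s', |w s * c s - w s' * c s'| ≤ 22 / Λ ^ 2 * |s - s'| := fun s s' =>
    (klrq_mul_lipschitz hwb hcb hwl hcl s s').trans (le_of_eq (by ring))
  have hin : ∀ s, s ≤ (Λ / 2) ^ 2 → w s * c s = 0 := fun s hs => by
    rw [hw, hc]; exact klrc_softer_partner_zero_of_le hΛ (by nlinarith)
  have hout : ∀ s, (4 * Λ) ^ 2 ≤ s → w s * c s = 0 := fun s hs => by
    rw [hw, hc]; exact klrc_softer_partner_zero_of_ge hΛ (by nlinarith)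
  have hm : ∫ s in Ioi (0 : ℝ), |w s * c s| / s ≤ 1 / 4 * Real.log 4 := by
    refine le_trans (le_of_eq (setIntegral_congr_fun measurableSet_Ioi fun s _ => ?_)) (klrc_softer_partner_mass_le hΛ)
    obtain ⟨h0, hba, h1⟩ := klrq_weights_mem hΛ s
    show |w s * c s| / s = (salmhoferCutoff (s / Λ ^ 2) - salmhoferCutoff (s / (4 * Λ) ^ 2)) * (1 - salmhoferCutoff (s / Λ ^ 2)) / s
    rw [hw, hc]; simp only; rw [abs_of_nonneg (klrc_softer_partner_mem h0 hba h1).1]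
  have h := klrq_planar_realProfile_mass_le B hδ1 hδ hκ hκ₁ hA hAsupp hA0 (G := fun s => w s * c s) (MF := 1 / 4) (ℓ := 22)
    hbd hlip hin hout hm hlo hhi hβ hn hM
  have hnum : (4 : ℝ) * 22 + 16 * (1 / 4) = 92 := by norm_num
  rw [hnum] at h
  exact h

include B hδ1 hδ hκ hκ₁ in
/-- **Transfer mass at scale `n`** (the hard⊗soft weight of `𝒲₄^{(n)} − 𝒱₄^{(n)}` at second order): `F = 2a(1 − a)`, `½∫ ≤ ¼·log 4`, `ℓ = 64/3`,
`M_F = 1/2` — valid at every `n ≤ n_β + 1` (no `1 ≤ n` needed). -/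
theorem klrq_planar_transfer_mass_le {A : ℝ × ℝ → ℂ} (hA : Continuous A) (hAsupp : ∀ p : ℝ × ℝ, A p ≠ 0 → |p.1| < π ∧ |p.2| < π)
    {A₀ : ℝ} (hA0 : ∀ p, ‖A p‖ ≤ A₀) {n : ℕ}
    {μ : ℝ} (hlo : a < μ - 4 * klScale klE0 n - κ₀) (hhi : μ + 4 * klScale klE0 n + κ₀ < b)
    {β : ℝ} (hβ : klBetaMin ≤ β) (hn : n ≤ nScales β + 1) {M : ℕ} (hM : β * (4 * klScale klE0 n) / (2 * Real.pi) + 1 ≤ M) :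
    ‖β⁻¹ • ∑ i : MatsubaraIdx M, ∫ p : ℝ × ℝ, A p *
        (((2 * (salmhoferCutoff ((matsubaraFreq β M i ^ 2 + klfb_band δ μ p ^ 2) / klScale klE0 n ^ 2) *
            (1 - salmhoferCutoff ((matsubaraFreq β M i ^ 2 + klfb_band δ μ p ^ 2) / klScale klE0 n ^ 2))) : ℝ) : ℂ) /
          (((matsubaraFreq β M i ^ 2 + klfb_band δ μ p ^ 2 : ℝ)) : ℂ))‖ ≤
      2 * Real.pi * (A₀ * (Real.pi * Real.sqrt 2 / (B.Dtmin - κ₁)) *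
        (1 / 2 * (1 / 2 * Real.log 4) + 1024 / Real.pi * (280 / 3) * ((Real.pi / β) / klScale klE0 n))) := by
  have hΛ := klth_klScale_pos n
  set Λ := klScale klE0 n with hΛdef
  set h : ℝ → ℝ := fun s => salmhoferCutoff (s / Λ ^ 2) with hh
  have hhb : ∀ s, 0 ≤ h s ∧ h s ≤ 1 := fun s => ⟨klrc_chi_nonneg _, klrc_chi_le_one _⟩
  have hhl : ∀ s s', |h s - h s'| ≤ (32 / 3) / Λ ^ 2 * |s - s'| := fun s s' => klrq_hard_lipschitz hΛ s s'
  have hbd : ∀ s, |2 * (h s * (1 - h s))| ≤ 1 / 2 := fun s => by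
    rw [abs_of_nonneg (klrc_transfer_nonneg (hhb s).1 (hhb s).2)]; exact klrc_transfer_le_half _
  have hlip : ∀ s s', |2 * (h s * (1 - h s)) - 2 * (h s' * (1 - h s'))| ≤ (64 / 3) / Λ ^ 2 * |s - s'| := by
    intro s s'
    have h1 : 2 * (h s * (1 - h s)) - 2 * (h s' * (1 - h s')) = 2 * (h s - h s') * (1 - (h s + h s')) := by ring
    rw [h1, abs_mul, abs_mul, abs_two]
    have h2 : |1 - (h s + h s')| ≤ 1 := by
      rw [abs_le]; constructor <;> linarith [(hhb s).1, (hhb s).2, (hhb s').1, (hhb s').2]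
    have h3 := hhl s s'
    have h0 : 0 ≤ |h s - h s'| := abs_nonneg _
    calc 2 * |h s - h s'| * |1 - (h s + h s')| ≤ 2 * |h s - h s'| * 1 :=
          mul_le_mul_of_nonneg_left h2 (by positivity)
      _ ≤ 2 * (32 / 3 / Λ ^ 2 * |s - s'|) := by linarith
      _ = 64 / 3 / Λ ^ 2 * |s - s'| := by ring
  have hin : ∀ s, s ≤ (Λ / 2) ^ 2 → 2 * (h s * (1 - h s)) = 0 := fun s hs => by
    rw [hh]; simp only; rw [klrc_transfer_zero_of_le hΛ (by nlinarith), mul_zero]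
  have hout : ∀ s, (4 * Λ) ^ 2 ≤ s → 2 * (h s * (1 - h s)) = 0 := fun s hs => by
    rw [hh]; simp only; rw [klrc_transfer_zero_of_ge hΛ (by nlinarith), mul_zero]
  have hm : ∫ s in Ioi (0 : ℝ), |2 * (h s * (1 - h s))| / s ≤ 1 / 2 * Real.log 4 := by
    refine le_trans (le_of_eq (setIntegral_congr_fun measurableSet_Ioi fun s _ => ?_)) (klrc_transfer_mass_le hΛ)
    show |2 * (h s * (1 - h s))| / s = 2 * (salmhoferCutoff (s / Λ ^ 2) * (1 - salmhoferCutoff (s / Λ ^ 2))) / s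
    rw [abs_of_nonneg (klrc_transfer_nonneg (hhb s).1 (hhb s).2)]
  have hres := klrq_planar_realProfile_mass_le B hδ1 hδ hκ hκ₁ hA hAsupp hA0 (G := fun s => 2 * (h s * (1 - h s))) (MF := 1 / 2)
    (ℓ := 64 / 3) hbd hlip hin hout hm hlo hhi hβ hn hM
  have hnum : (4 : ℝ) * (64 / 3) + 16 * (1 / 2) = 280 / 3 := by norm_num
  rw [hnum] at hres
  exact hres

end Frame

end Summit.HubbardSuperconductivity.HubbardSuperconductivity.Theorems.KLRegimeSplit

end
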